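import Summits.ResolutionOfSingularities.ResolutionOfSingularities.Theorems.RadicialJungCleanResolvesRegularType

/-!
# Route `RadicialJung`, line `CleanModelsSuffice`: one charged parameter gives a regular cover

Helper for the exceptionalisation game of `CleanModelsSuffice` (stmt-ResolutionOfSingularities-15883):
if the degree-`p` purely inseparable extension `L/K`, `K = Frac O`, is generated by `y` with
`y^p = u * t^a` where `u ∈ O` is a unit, `t ∈ 𝔪_O ∖ 𝔪_O²` is a regular parameter of the regular
local ring `O` and `p ∤ a` (ONE charged parameter), then the integral closure of `O` in `L` is a
regular local ring. Proof: pick `m, s` with `a * m = p * s + 1`; then `y' = y^m / t^s` satisfies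
`y'^p = u^m * t`, still generates `L/K`, and `u^m * t - 0^p ∈ 𝔪_O ∖ 𝔪_O²`, so the transversal case
`CleanResolves.isRegularLocalRing_integralClosure_of_transversal` applies.
-/

noncomputable section

set_option linter.dupNamespace false -- mandated namespace of this single-conjunct summit

namespace Summit.ResolutionOfSingularities.ResolutionOfSingularities.Theorems.RadicialJung.CleanModelsSuffice

/-- **One charged parameter: the normalised cover is regular.** Let `O` be a regular local ring of
characteristic `p` with fraction field `K`, `L/K` a field extension of degree `p`, and `y ∈ L ∖ K`
with `y^p = u * t^a` for a unit `u ∈ O`, a regular parameter `t ∈ 𝔪_O ∖ 𝔪_O²` and an exponent `a`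
prime to `p`. Then `integralClosure O L` is a regular local ring: writing `a * m = p * s + 1`, the
element `y' = y^m / t^s ∈ L ∖ K` has `y'^p = u^m * t`, which differs from `0^p` by a regular
parameter, so `CleanResolves.isRegularLocalRing_integralClosure_of_transversal` applies. [folklore] -/
theorem isRegularLocalRing_integralClosure_of_one_charged {O K L : Type} [CommRing O]
    [IsRegularLocalRing O] [Field K] [Algebra O K] [IsFractionRing O K] [Field L] [Algebra K L]
    [Algebra O L] [IsScalarTower O K L] (p : ℕ) (hp : p.Prime) [CharP O p] [CharP L p]
    (hdeg : Module.finrank K L = p) (t u : O) (ht : t ∈ IsLocalRing.maximalIdeal O)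
    (ht2 : t ∉ IsLocalRing.maximalIdeal O ^ 2) (hu : IsUnit u) (a : ℕ) (ha : ¬ p ∣ a) (y : L)
    (hy : y ∉ Set.range (algebraMap K L)) (hyp : y ^ p = algebraMap O L (u * t ^ a)) :
    IsRegularLocalRing (integralClosure O L) := by
  haveI : FiniteDimensional K L := Module.finite_of_finrank_pos (by rw [hdeg]; exact hp.pos)
  -- `O → L` is injective, so `t ≠ 0` stays non-zero in `L`; and `y ≠ 0`
  have hOL : Function.Injective (algebraMap O L) := by
    rw [IsScalarTower.algebraMap_eq O K L]
    exact (algebraMap K L).injective.comp (IsFractionRing.injective O K)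
  have ht0 : t ≠ 0 := by
    rintro rfl
    exact ht2 (zero_mem _)
  have htL : algebraMap O L t ≠ 0 := (map_ne_zero_iff _ hOL).mpr ht0
  have hy0 : y ≠ 0 := by
    rintro rfl
    exact hy ⟨0, map_zero _⟩
  -- exponent arithmetic: `a * m = p * s + 1`
  have hcop : Nat.Coprime a p := ((Nat.Prime.coprime_iff_not_dvd hp).mpr ha).symm
  obtain ⟨m, -, hm⟩ := Nat.exists_mul_mod_eq_one_of_coprime hcop hp.one_lt
  obtain ⟨s, hams⟩ : ∃ s : ℕ, a * m = p * s + 1 :=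
    ⟨a * m / p, by
      have h := Nat.div_add_mod (a * m) p
      rw [hm] at h
      exact h.symm⟩
  -- the new generator `y' = y^m / t^s`
  set y' : L := y ^ m / algebraMap O L t ^ s with hy'_def
  have hypm : y ^ (p * m) = algebraMap O L ((u * t ^ a) ^ m) := by
    rw [pow_mul, hyp, map_pow]
  have hyp' : y' ^ p = algebraMap O L (u ^ m * t) := by
    rw [hy'_def, div_pow, div_eq_iff (pow_ne_zero _ (pow_ne_zero _ htL)), ← pow_mul, mul_comm m p,
      hypm, ← map_pow, ← map_pow, ← map_mul]
    congr 1
    rw [mul_pow, ← pow_mul, ← pow_mul, hams]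
    ring
  have hy' : y' ∉ Set.range (algebraMap K L) := by
    intro hmem
    apply hy
    rw [← IntermediateField.mem_bot] at hmem ⊢
    have htF : algebraMap O L t ∈ (⊥ : IntermediateField K L) := by
      rw [IsScalarTower.algebraMap_apply O K L]
      exact (⊥ : IntermediateField K L).algebraMap_mem _
    have hym : y ^ m ∈ (⊥ : IntermediateField K L) := by
      have h : y ^ m = y' * algebraMap O L t ^ s := by
        rw [hy'_def, div_mul_cancel₀ _ (pow_ne_zero _ htL)]
      rw [h]
      exact mul_mem hmem (pow_mem htF _)
    have hypF : y ^ p ∈ (⊥ : IntermediateField K L) := by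
      rw [hyp, IsScalarTower.algebraMap_apply O K L]
      exact (⊥ : IntermediateField K L).algebraMap_mem _
    have key : y = (y ^ m) ^ a / (y ^ p) ^ s := by
      rw [← pow_mul, mul_comm m a, hams, ← pow_mul, pow_succ,
        mul_div_cancel_left₀ _ (pow_ne_zero _ hy0)]
    rw [key]
    exact div_mem (pow_mem hym _) (pow_mem hypF _)
  -- conclude by the transversal regular-type case with `c = 0`
  refine CleanResolves.isRegularLocalRing_integralClosure_of_transversal (K := K) hp hdeg
    (u ^ m * t) y' hy' hyp' 0 ?_ ?_
  · rw [zero_pow hp.ne_zero, sub_zero]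
    exact Ideal.mul_mem_left _ _ ht
  · rw [zero_pow hp.ne_zero, sub_zero]
    exact fun h => ht2 ((Ideal.unit_mul_mem_iff_mem _ (hu.pow m)).mp h)

end Summit.ResolutionOfSingularities.ResolutionOfSingularities.Theorems.RadicialJung.CleanModelsSuffice

end
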